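import Summits.QuantumFields.YangMills.Theorems.PoincareLipschitzIteratedOfAvgStabilityModGauge
import Literature.MathematicalPhysics.QuantumFieldTheory.Balaban1983to89.B3Taylor310LocalRemainder
import HarnessLib

/-!
# Crux stmt-QuantumFields-19936 `HistoryTailL`, K2 at depth (route crux `BlockLipschitzL`, stmt-QuantumFields-23533): THE TOWER GUARDS —
# the crux's hierarchical windows around `a` bound the (0.4) LOOP VARIABLES of `Ū^i(U)` at EVERY height `i ≤ j` on the whole tower under `a`

WHY (K2 supplier plan of record, w2 g10 memo d4b68d58 §1∕§3, card v1.27 (c)).  Every brick of the re-gauged nonlinear induction (E1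
✓`Prop7AvgTrueLinearisation.norm_avgFun_ratio_sub_one_sub_trueLin_le`, E5, E8 ✓`sqrt_sum_normSq_reduced_sub_lineIter_le`, E10) is guarded by the
loop-variable sizes of the BACKGROUND tower: `dist1(W^{(i)}_idx(c)) ≤ a_i ≤ 1/24` at every height `i` and every coarse bond `c` it reads.  On hStab's
good set the only input is the crux's window at height `i`; THIS FILE turns it into the guard, for every level-`(i+1)` bond `c` whose scaled corner is
within torus distance `64·L^{j+1} − 31·L^{i+1}` of `a.src·L^{j+1}` (the whole tower of blocks under the footprint of `∂a` and much more):
`dist1(loopHol (Ū^i U) c idx) ≤ ((5L)²/4)·θBal(K−i)` (`dist1_loopHol_iter_le_of_windows`), via [Balaban1985Averaging]'s local Stokes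
✓`BlockAveragingPlaquetteBoundLocal.dist1_loopHol_le_local` and this lane's level-generic bookkeeping ✓`tdist_le_of_near_level` (the three blocks of `c`
are within `9L·L^i` of `c.src·L^{i+1}`; triangle inequality ✓`B3Taylor310LocalRemainder.tdist_triangle`).  With ✓`PoincareLipschitzThresholdSums.sum_θBal_le`
the sizes `a_i := (25L²/4)·θBal(K−i)` are SUMMABLE over the heights uniformly (`Σ_i a_i ≤ (25L²/4)·C(b₀,p₀)γ^{1/4}/(1−2^{−1/4})`), which is the
k-uniformity input of E8.  Companion: the guard `((5L)²/4)·θBal(K−i) ≤ 1/6 < δ_2` under `θBal ≤ 1/(75(L+1)²)` is ✓`PoincareLipschitzLevelOneLipschitz`'s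
arithmetic (`sixth_le_half_deltaSU_two`).

Def-free; nothing of hStab, `BlockLipschitzL`, `HistoryTailL`, rung R3 (YM₃ on T³ — not d = 4, not Clay) or a summit statement is proved.
LEAD seat ym-ust-19936-w1 g7 (cell ym3-torus), `--supports stmt-QuantumFields-23533`.
-/

noncomputable section

open scoped BigOperators

namespace Summit.QuantumFields.YangMills.Theorems.PoincareLipschitzTowerGuards

open Literature.MathematicalPhysics.QuantumFieldTheory.Balaban1983to89
open Literature.MathematicalPhysics.QuantumFieldTheory.Balaban1983to89.T3ContinuumYM3Torus
open Literature.MathematicalPhysics.QuantumFieldTheory.Balaban1983to89.T3UnitLawDensityEML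
open T4Continuum BlockAveraging AveragingRT ExpMeanLog T3UnitScaleTilt
open Literature.MathematicalPhysics.QuantumFieldTheory.Balaban1983to89.B3Taylor310LocalRemainder (tdist_triangle tdist_comm)
open Summit.QuantumFields.YangMills.Theorems.PoincareLipschitzIteratedOfAvgStability (tdist_le_of_near_level)

variable {F : T3Family} {K j i : ℕ} {γ b₀ p₀ : ℝ}

/-- **THE THREE BLOCKS OF A COARSE BOND ARE INSIDE THE WINDOW OF EVERY FAR-ENOUGH CORNER**: if the level-`(i+1)` bond `c` has its scaled source
within torus distance `R` of a scaled site `A`, then every level-`i` plaquette based in `B(c₋ − e_{dir c}) ∪ B(c₋) ∪ B(c₊)` has its scaled corner within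
`R + 9L·L^i` of `A` (`i + 3 ≤ K`). [folklore] -/
theorem tdist_le_of_mem_three_blocks (hiK : i + 3 ≤ K) (c : PBond (F.P K) (i + 1)) (A : Site (F.P K) 0) {R : ℕ}
    (hc : Site.tdist (fun k => ((((c.src k).val * F.L ^ (i + 1) : ℕ)) : ZMod ((F.P K).sitesPerDir 0))) A ≤ R)
    (q : Plaq (F.P K) i) (hq : blockOf q.src = c.src.unshift c.dir ∨ blockOf q.src = c.src ∨ blockOf q.src = c.tgt) :
    Site.tdist (fun k => ((((q.src k).val * F.L ^ i : ℕ)) : ZMod ((F.P K).sitesPerDir 0))) A ≤ R + 9 * F.L * F.L ^ i := by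
  -- the block of `q` is within `{−1, 0, 1}` of `c.src` coordinatewise
  have hnear : ∀ k, blockOf q.src k = c.src k ∨ blockOf q.src k = c.src k + 1 ∨ blockOf q.src k = c.src k - 1 ∨
      blockOf q.src k = c.src k + 2 := by
    intro k
    rcases hq with h | h | h
    · rw [h]
      by_cases hk : k = c.dir
      · subst hk; right; right; left; simp [Site.unshift]
      · left
        simp only [Site.unshift, Function.update_apply]
        rw [if_neg hk]
    · rw [h]; left; rfl
    · rw [h]
      by_cases hk : k = c.dir
      · subst hk; right; left; simp [PBond.tgt, Site.shift]
      · left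
        simp only [PBond.tgt, Site.shift, Function.update_apply]
        rw [if_neg hk]
  have h1 := tdist_le_of_near_level hiK c.src q.src hnear
  have h2 := tdist_triangle (fun k => ((((q.src k).val * F.L ^ i : ℕ)) : ZMod ((F.P K).sitesPerDir 0)))
    (fun k => ((((c.src k).val * F.L ^ (i + 1) : ℕ)) : ZMod ((F.P K).sitesPerDir 0))) A
  omega

/-- ★ **THE TOWER GUARDS FROM THE WINDOWS.**  Let `U` be locally hierarchically small around the level-`(j+1)` plaquette `a` (the crux's windows at
all heights `< j+1`), `i ≤ j`, `i + 3 ≤ K`, and let `c` be a level-`(i+1)` bond whose scaled source is within torus distance `64·L^{j+1} − 31·L^{i+1}` of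
`a.src·L^{j+1}`.  Then every (0.4) loop variable of `Ū^i(U)` at `c` satisfies `dist1 ≤ ((5L)²/4)·θBal(K−i)` — the per-level guard `a_i` of the
true-linearisation bricks. [cite: Balaban1985Averaging, (19)-(20) p.21; Balaban1987RG1, (0.4) p.253] -/
theorem dist1_loopHol_iter_le_of_windows (hiK : i + 3 ≤ K) (hij : i ≤ j) (hγ : 0 < γ) (hγ1 : γ ≤ 1) (hb : 0 < b₀)
    (a : Plaq (F.P K) (j + 1)) (U : GaugeField (F.P K) 0 (Matrix.specialUnitaryGroup (Fin 2) ℂ))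
    (hU : (∀ (i : ℕ) (q : Plaq (F.P K) i), i < j + 1 → Site.tdist (fun k => ((((q.src k).val * F.L ^ i : ℕ)) : ZMod ((F.P K).sitesPerDir 0))) (fun k => ((((a.src k).val * F.L ^ (j + 1) : ℕ)) : ZMod ((F.P K).sitesPerDir 0))) + 64 * F.L ^ i ≤ 64 * F.L ^ (j + 1) → GaugeGroup.dist1 (GaugeField.plaqHol (Averaging.iter (fun i' => BlockAveraging.blockAvg (P := F.P K) (j := i') T3UnitLawDensityEML.ℰp) i U) q) < T3UnitScaleTilt.θBal F.L γ b₀ p₀ (K - i)))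
    (c : PBond (F.P K) (i + 1))
    (hc : Site.tdist (fun k => ((((c.src k).val * F.L ^ (i + 1) : ℕ)) : ZMod ((F.P K).sitesPerDir 0)))
        (fun k => ((((a.src k).val * F.L ^ (j + 1) : ℕ)) : ZMod ((F.P K).sitesPerDir 0))) + 31 * F.L ^ (i + 1) ≤ 64 * F.L ^ (j + 1))
    (idx : Idx (F.P K)) :
    GaugeGroup.dist1 (loopHol (Averaging.iter (fun i' => BlockAveraging.blockAvg (P := F.P K) (j := i') T3UnitLawDensityEML.ℰp) i U) c idx) ≤
      ((((5 * F.L : ℕ)) : ℝ) ^ 2 / 4) * θBal F.L γ b₀ p₀ (K - i) := by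
  have hL3 : 3 ≤ F.L := (by obtain ⟨k, hk⟩ := F.hL.1; have := F.hL.2; omega)
  have hir : i + 1 ≤ (F.P K).m + (F.P K).K := by
    show i + 1 ≤ F.m + K
    have := F.hm; omega
  have hθ0 : 0 ≤ θBal F.L γ b₀ p₀ (K - i) := (T3MinimiserStabilityReduction.θBal_pos (by omega) hγ hγ1 hb p₀ (K - i)).le
  -- the plaquettes in the three blocks of `c` are inside the window at height `i`
  have hwin : ∀ q : Plaq (F.P K) i, (blockOf q.src = c.src.unshift c.dir ∨ blockOf q.src = c.src ∨ blockOf q.src = c.tgt) →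
      dist1 (GaugeField.plaqHol (Averaging.iter (fun i' => BlockAveraging.blockAvg (P := F.P K) (j := i') T3UnitLawDensityEML.ℰp) i U) q) < θBal F.L γ b₀ p₀ (K - i) := by
    intro q hq
    have h1 := tdist_le_of_mem_three_blocks hiK c
      (fun k => ((((a.src k).val * F.L ^ (j + 1) : ℕ)) : ZMod ((F.P K).sitesPerDir 0))) le_rfl q hq
    refine hU i q (by omega) ?_
    have hLi : 0 < F.L ^ i := pow_pos (by omega) i
    have e : F.L ^ (i + 1) = F.L * F.L ^ i := by rw [pow_succ]; ring
    have ho : 9 * F.L * F.L ^ i = 9 * F.L ^ (i + 1) := by rw [e]; ring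
    have h3 : 64 * F.L ^ i ≤ 22 * F.L ^ (i + 1) := by rw [e]; nlinarith
    omega
  have h := BlockAveragingPlaquetteBoundLocal.dist1_loopHol_le_local hθ0 hir c hwin idx
  refine h.trans (le_of_eq ?_)
  have e5 : ((((F.P K).d + 2) * (F.P K).L : ℕ) : ℝ) = (((5 * F.L : ℕ)) : ℝ) := by
    show ((((3 + 2) * F.L : ℕ)) : ℝ) = (((5 * F.L : ℕ)) : ℝ)
    norm_num
  rw [e5]

/-- **COROLLARY — the guard in the form the bricks want** (`a_i ≤ 1/24` and `< δ_2`): with `θBal(K−i) ≤ 1/(75(L+1)²)` the bound above is `≤ 1/12`,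
hence `≤ 1/24`-type guards follow after one more factor of two in `γ₁` (stated here as `≤ 1/12 < δ_2/… `; consumers pick their threshold through
✓`T3Thresholds.exists_gamma_forall_θBal_le`). [folklore] -/
theorem loopGuard_le_twelfth {θ : ℝ} (hθ : θ ≤ 1 / (75 * ((F.L : ℝ) + 1) ^ 2)) :
    ((((5 * F.L : ℕ)) : ℝ) ^ 2 / 4) * θ ≤ 1 / 12 := by
  have h1 : ((((5 * F.L : ℕ)) : ℝ) ^ 2 / 4) * (1 / (75 * ((F.L : ℝ) + 1) ^ 2)) = (F.L : ℝ) ^ 2 / (12 * ((F.L : ℝ) + 1) ^ 2) := by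
    push_cast; field_simp; ring
  have hL0 : (0 : ℝ) ≤ F.L := Nat.cast_nonneg _
  have h2 : (F.L : ℝ) ^ 2 / (12 * ((F.L : ℝ) + 1) ^ 2) ≤ 1 / 12 := by
    rw [div_le_div_iff₀ (by positivity) (by norm_num)]
    nlinarith
  calc ((((5 * F.L : ℕ)) : ℝ) ^ 2 / 4) * θ ≤ ((((5 * F.L : ℕ)) : ℝ) ^ 2 / 4) * (1 / (75 * ((F.L : ℝ) + 1) ^ 2)) :=
        mul_le_mul_of_nonneg_left hθ (by positivity)
    _ ≤ 1 / 12 := by rw [h1]; exact h2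

end Summit.QuantumFields.YangMills.Theorems.PoincareLipschitzTowerGuards

end
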